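import Summits.QuantumFields.YangMills.Theses.ForcedResponseSkewness
import Summits.QuantumFields.YangMills.Theorems.ForcedResponseSkewnessRunningCouplingCeilingDefs

/-!
# Skeleton «pointwise-log-ceiling» for crux `RunningCouplingCeiling` (stmt-QuantumFields-23617) of route
# `ForcedResponseSkewness` (lead `ym-line-frs-p1`; the ideator's bc/ has no skeleton for this crux)

RunningCouplingCeiling ⇐ stub_pointwise (PHYSICS, XL: a clause-(i) floor for `(a, v)` pins the unit to the
                                         correlation length, and asymptotic freedom then gives POINTWISE ceilings on
                                         the torus covariance of the action densities below the unit — bounded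
                                         `|Cov| ≤ C₂`, scale-free `d⁸|Cov| ≤ C₁` beyond `n₀` lattice units, and the
                                         running-coupling decay `d⁸|Cov| ≤ C₀/log²(1/(a(β)·d))` for
                                         `n₀ ≤ d`, `a(β)·d ≤ 1/2` (torus distance `d`); Bałaban-class + the
                                         floor-pins-unit lemma of the route's layer-2 plan, both inside this stub)
                        + stub_smear     (ANALYSIS, L, provable now: a kernel with those three bounds, smeared with
                                         `θv ⊗ v` at spacing `l·t`, `l ∈ [Λ, 2Λ]`, on tori `t·L ≥ Λ₆`, is `≤ C/log²Λ`,
                                         for `v` Schwartz with `tsupport v ⊆ {0 < y₀}` AND time-bounded support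
                                         `tsupport v ⊆ {y₀ ≤ T}`: Riemann-sum bounds for Schwartz functions, flatness of
                                         `v` at the wall `y₀ = 0` (`|v(w)| ≤ B·w₀^k`), and NO time wrap-around once
                                         `Λ₆ > 2T`, so `d_torus ≥ (|u₀|+|w₀|)/s` for every pair)
                        + stub_tails     (GUARD — the typed crux quantifies over ALL Schwartz `v` with
                                         `tsupport v ⊆ {0 < y₀}`; for `v` whose support is unbounded in time the Schwartz
                                         tails of `θv` and `v` overlap across the periodic time boundary of the minimal
                                         admissible torus `a(β)·L ≈ Λ₆`, and the non-integrable `|u−w|⁻⁸` singularity of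
                                         the dimension-4 density makes `Q2_{β,L,l·aβ}(θv,v)` grow like `a(β)⁻³·tail²` —
                                         so this residue is believed FALSE whenever its floor hypothesis is met, and is
                                         isolated here ONLY to make the mis-typing visible: it disappears verbatim when the
                                         planner adds `HasCompactSupport v` (or a time bound on `tsupport v`) to the crux.
                                         DO NOT STAFF `stub_tails`; see `Lines/pointwise-log-ceiling.md`.)
The composition `RunningCouplingCeiling_of` is PROVED (case split on time-boundedness of `tsupport v`); sorries
live only in the three stubs.  No summit is proved by any of this (leaf R2a `BalabanLadder.NT`, conditional line).
-/

set_option autoImplicit false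

noncomputable section

namespace Summit.QuantumFields.YangMills.Cruxes.RunningCouplingCeiling.Pointwise

open scoped SchwartzMap
open MeasureTheory Filter Topology
open Literature.MathematicalPhysics.QuantumFieldTheory Literature.MathematicalPhysics.QuantumLattice
open Literature.Probability.LatticeModels
open Summit.QuantumFields.YangMills.Cruxes.OSLegsFromFemtoAndGap.DlrCollarTransfer
open Summit.QuantumFields.YangMills.Theses.ForcedResponseSkewness

/-! ## The registered stubs (statements in `Theorems/ForcedResponseSkewnessRunningCouplingCeilingDefs.lean`, p589210) -/

theorem stub_pointwise : PointwiseSig := by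
  sorry

theorem stub_smear : SmearSig := by
  sorry

theorem stub_tails : TailsSig := by
  sorry

/-! ## Composition (kernel-checked, no sorry outside the stubs) -/

/-- COMPOSITION: for time-bounded `tsupport v`, the pointwise ceilings of `stub_pointwise` for the kernel
`torusCov` feed the analysis of `stub_smear` at unit `t = a(β)` (`a(β) ≤ t₀` eventually since `a → 0`;
thresholds = max); otherwise the guard `stub_tails`. -/
theorem RunningCouplingCeiling_of (hpt : PointwiseSig) (hsm : SmearSig) (htl : TailsSig) :
    RunningCouplingCeiling := by
  intro G _ _ _ _ hG
  letI : MeasurableSpace G := borel G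
  haveI : BorelSpace G := ⟨rfl⟩
  intro r a v hapos hlim hsupp hfloor
  by_cases hT : ∃ T : ℝ, tsupport v ⊆ {y : EuclideanSpace ℝ (Fin 4) | y 0 ≤ T}
  · obtain ⟨T, hT⟩ := hT
    obtain ⟨C₀, C₁, C₂, n₀, β₀, Λ₀, hK⟩ := hpt G hG r a v hapos hlim hsupp hfloor
    obtain ⟨C, hC⟩ := hsm v T hsupp hT C₀ C₁ C₂ n₀
    refine ⟨C, fun Λ hΛ => ?_⟩
    obtain ⟨t₀, Λ₆, ht₀, h⟩ := hC Λ hΛ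
    obtain ⟨β₁, hβ₁⟩ := Filter.eventually_atTop.1 (hlim.eventually (Iic_mem_nhds ht₀))
    refine ⟨max β₀ β₁, max Λ₀ Λ₆, fun β hβ L hL l hl => ?_⟩
    have hb := h (a β) (hapos β) (hβ₁ β (le_trans (le_max_right _ _) hβ)) L
      (le_trans (le_max_right _ _) hL) (torusCov G r β L)
      (hK β (le_trans (le_max_left _ _) hβ) L (le_trans (le_max_left _ _) hL)) l hl
    rw [Q2_eq_sum_torusCov]
    exact hb
  · exact htl G hG r a v hapos hlim hsupp hfloor hT

/-- The crux from the three stubs (sorries live ONLY in the stubs). -/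
theorem RunningCouplingCeiling_holds : RunningCouplingCeiling :=
  RunningCouplingCeiling_of stub_pointwise stub_smear stub_tails

end Summit.QuantumFields.YangMills.Cruxes.RunningCouplingCeiling.Pointwise

end
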